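import Literature.AnabelianGeometry.EtaleTheta.DoubleUnderlineIotaStable
import Literature.AnabelianGeometry.EtaleTheta.SettingModelChiDoubleUnderlineCensus
import Literature.AnabelianGeometry.EtaleTheta.SettingModelChiInversionAut
import Literature.AnabelianGeometry.EtaleTheta.SettingModelChiThetaCocycleSec
import Literature.AnabelianGeometry.EtaleTheta.SettingModelTateInversionXuu
import Literature.AnabelianGeometry.EtaleTheta.SettingModelTateInversionAut
import Literature.AnabelianGeometry.EtaleTheta.SettingModelTateDoubleUnderlineEtaRes
import Literature.AnabelianGeometry.EtaleTheta.SettingModelTateKummerData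
import HarnessLib

/-!
# [EtTh] Def. 2.5 (i)(b) predicates `DoubleUnderline.IotaStable` / `DoubleUnderline.CuspAdapted`: NON-VACUITY at the
# χ-model constructor sites of the choice `X̲̲` (stage 1 `modelχ`, stage 2 `modelχq`, cusped `modelχ′`) — proof-only

Mochizuki, *The Étale Theta Function and its Frobenioid-theoretic Manifestations* [EtTh], Publ. RIMS **45** (2009), §2,
Def. 2.5 (i) PRIMS PDF p. 39 («compatible with the `{±1}`-structure»; «determined by the choice of a splitting of
`D_x → G_K`»), Def. 2.7 p. 41 [cite: MochizukiEtTh2009, Def 2.5 (i) p.39].  Cell `abc-iut`, layer L2, seat abc-iut-L2-t8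
(gen 6); L2 v-next census item C10 (predicate route, R269), PROOF-ONLY sequel of `DoubleUnderlineIotaStable`: the two
predicates are INHABITED at every χ-model constructor site of `EtaleThetaData.DoubleUnderline`, by abc-iut-L2-d1's site
facts consumed BY NAME (`map_Huuχ_twistedInversion`, `SettingModelChiInversionTheta`; `map_Huuχq_inversionχq`,
`SettingModelTateInversionXuu`; `map_aug_decomp_inf_Huuχ_modelχ'`, `SettingModelChiDoubleUnderlineCensus`) — nothing restated:

* stage 1, `D := modelχ p` (abc-iut-L2-t1), `X̲̲ := doubleUnderlineχSec p l hl` (abc-iut-L2-d1, `Π^tp_X̲̲ = Huuχ p l`),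
  `ι :=` the twisted inversion `twistedInversionTop (chi p) _` of `Π^tp_X = Γ ⋊_χ G_{ℚ_p}` — an `IsInversionAut` in
  abc-iut-L2-t1's sense by abc-iut-L2-d1's `isInversionAut_twistedInversion_modelχ` (`SettingModelChiInversionAut`):
  `IotaStable` HOLDS (`iotaStable_doubleUnderlineχSec_twistedInversion`), indeed for EVERY `X̲̲` over `modelχ` with
  `Π^tp_X̲̲ = Huuχ p l`, hence `Π^tp_Ÿ̲̲`, `Π^tp_Y̲̲` are ι-stable; joint / setting-free census forms
  `exists_doubleUnderline_isInversionAut_iotaStable_modelχ`, `ThetaSetting.exists_isEtThOrigin_doubleUnderline_iotaStable`;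
* stage 2, `D := modelχq p i j hj` (abc-iut-L2-t5, Tate shear), `X̲̲ := E.doubleUnderlineχqOfEtaRes …` (abc-iut-L2-d1,
  `Π^tp_X̲̲ = Huuχq = dUU l ⋊ G_{ℚ_p}`) for every étale-theta datum `E` and `eta_res` witness, `ι := inversionχq p i j`
  (abc-iut-w5-d249 / abc-iut-L2-d1's cocycle-corrected stage-2 inversion): `IotaStable` HOLDS;
* cusp clause: at abc-iut-w5-d029's cusped χ-model `modelχ′` every `X̲̲` with `Π^tp_X̲̲ = Huuχ p l` is `CuspAdapted` to
  every point (the Galois section `inr` lies in `D_x ∩ Π^tp_X̲̲`); at `modelχ` the clause is vacuous (`Pt` empty) and is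
  recorded in that form.
v2 (append-only): the STAGE-2 joint forms with abc-iut-L2-d1's `isInversionAut_inversionχq` (`SettingModelTateInversionAut`):
`Π^tp_Ÿ̲̲` / `Π^tp_Y̲̲` of `doubleUnderlineχqOfEtaRes` are ι-stable, `exists_doubleUnderline_isInversionAut_iotaStable_modelχq`,
`ThetaSetting.exists_isEtThOrigin_doubleUnderline_iotaStable_stageTwo` (over any stage-2 Kummer datum, class `etaDdχq`).
SEMI-SYNTHETIC MODELS — consistency evidence for the typed interface only; nothing of [EtTh] asserted; no side taken on
[IUTchIII] Cor. 3.12; typed ≠ proved.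
-/

noncomputable section

namespace Literature.AnabelianGeometry.EtaleTheta.SettingModel

open Literature.AnabelianGeometry.SemiGraphs

variable (p : ℕ) [Fact p.Prime]

/-! ### Stage 1: the twisted inversion of `modelχ` stabilises every `X̲̲` with `Π^tp_X̲̲ = Huuχ p l` -/

/-- **`IotaStable` HOLDS at the stage-1 constructor sites**: every choice `X̲̲` over `modelχ p` whose `Π^tp_X̲̲` is
`Huuχ p l` is stable under the twisted inversion (abc-iut-L2-d1's `map_Huuχ_twistedInversion`).
[cite: MochizukiEtTh2009, Def 2.5 (i) p.39] -/
theorem iotaStable_twistedInversion_of_Huu_eq {E : (ThetaSetting.modelχ p).EtaleThetaData} {l : ℕ+}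
    (C : E.DoubleUnderline l) (hC : C.Huu = Huuχ p l) :
    C.IotaStable (twistedInversionTop (chi p) (isInducing_leftRightχ p)) :=
  ⟨by rw [hC]; exact map_Huuχ_twistedInversion p l⟩

/-- **`IotaStable` HOLDS for the choice `X̲̲` OF RECORD at stage 1**, `doubleUnderlineχSec p l hl` (the section datum
carrying the model's theta class). [cite: MochizukiEtTh2009, Def 2.5 (i) p.39] -/
theorem iotaStable_doubleUnderlineχSec_twistedInversion (l : ℕ+) (hl : Odd (l : ℕ)) :
    (doubleUnderlineχSec p l hl).IotaStable (twistedInversionTop (chi p) (isInducing_leftRightχ p)) :=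
  iotaStable_twistedInversion_of_Huu_eq p _ (doubleUnderlineχSec_Huu p l hl)

/-- … hence the restricted inversion `ι|Π^tp_X̲̲` of the record `X̲̲` EXISTS as a topological automorphism agreeing with
`ι` (the `(φ, hφ)` binder pair; abc-iut-L2-d1's `exists_restrict_twistedInversion_Huuχ` re-derived through the predicate).
[cite: MochizukiEtTh2009, Def 2.5 (i) p.39] -/
theorem exists_restrict_doubleUnderlineχSec_twistedInversion (l : ℕ+) (hl : Odd (l : ℕ)) :
    ∃ φ : ↥(doubleUnderlineχSec p l hl).Huu ≃ₜ* ↥(doubleUnderlineχSec p l hl).Huu,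
      ∀ g, ((φ g : (doubleUnderlineχSec p l hl).Huu) : (ThetaSetting.modelχ p).PiTemp) =
        twistedInversionTop (chi p) (isInducing_leftRightχ p) g :=
  (iotaStable_doubleUnderlineχSec_twistedInversion p l hl).exists_restrict

/-- **`Π^tp_Ÿ̲̲` and `Π^tp_Y̲̲` of the record `X̲̲` are ι-stable** (`IotaStable.map_GtpYdd_inf_Huu` / `.map_GtpY_inf_Huu` fed with
abc-iut-L2-d1's `isInversionAut_twistedInversion_modelχ`, i.e. abc-iut-L2-t1's `IsInversionAut` at the χ-model).
[cite: MochizukiEtTh2009, Def 2.7 p.41] -/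
theorem map_GtpYdd_inf_Huu_doubleUnderlineχSec_twistedInversion (l : ℕ+) (hl : Odd (l : ℕ)) :
    ((ThetaSetting.modelχ p).GtpYdd ⊓ (doubleUnderlineχSec p l hl).Huu).map
        (twistedInversionTop (chi p) (isInducing_leftRightχ p)).toMulEquiv.toMonoidHom =
      (ThetaSetting.modelχ p).GtpYdd ⊓ (doubleUnderlineχSec p l hl).Huu ∧
    ((ThetaSetting.modelχ p).GtpY ⊓ (doubleUnderlineχSec p l hl).Huu).map
        (twistedInversionTop (chi p) (isInducing_leftRightχ p)).toMulEquiv.toMonoidHom =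
      (ThetaSetting.modelχ p).GtpY ⊓ (doubleUnderlineχSec p l hl).Huu :=
  ⟨(iotaStable_doubleUnderlineχSec_twistedInversion p l hl).map_GtpYdd_inf_Huu
      (isInversionAut_twistedInversion_modelχ p).thm16i,
    (iotaStable_doubleUnderlineχSec_twistedInversion p l hl).map_GtpY_inf_Huu (isInversionAut_twistedInversion_modelχ p)⟩

/-- **Joint form at stage 1**: over `modelχ p` there EXIST an étale-theta datum with non-trivial `η̈^Θ`, a choice `X̲̲` for it
and an INVERSION AUTOMORPHISM `ι` in the sense of Prop. 1.5 (iii) (abc-iut-L2-t1's `IsInversionAut`: over `K`, `−1` on `Z` and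
on `(Δ^tp_X)^ell`, preserving the `Y_N`, `Z_N`) under which `X̲̲` is STABLE — while `Π^tp_X̲̲` is NOT normal in `Π^tp_X`
(`l > 1`): the `{±1}`-compatibility is a property of the pair `(X̲̲, ι)`, not of `X̲̲` alone.
[cite: MochizukiEtTh2009, Def 2.5 (i) p.39] -/
theorem exists_doubleUnderline_isInversionAut_iotaStable_modelχ (l : ℕ+) (hl : Odd (l : ℕ)) (hl1 : 1 < (l : ℕ)) :
    ∃ (E : (ThetaSetting.modelχ p).EtaleThetaData) (C : E.DoubleUnderline l)
      (ι : (ThetaSetting.modelχ p).PiTemp ≃ₜ* (ThetaSetting.modelχ p).PiTemp),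
      E.etaDd ≠ 1 ∧ (ThetaSetting.modelχ p).IsInversionAut ι ∧ C.IotaStable ι ∧ ¬ C.Huu.Normal :=
  ⟨etaleThetaDataχSec p (etaDdχ p), doubleUnderlineχSec p l hl, twistedInversionTop (chi p) (isInducing_leftRightχ p),
    etaDdχ_ne_one p, isInversionAut_twistedInversion_modelχ p, iotaStable_doubleUnderlineχSec_twistedInversion p l hl,
    not_normal_Huu_doubleUnderlineχSec p l hl hl1⟩

/-- **Setting-free census form**: some theta setting satisfying the §1 guard `IsEtThOrigin` carries an étale-theta datum
with `η̈^Θ ≠ 1`, a choice `X̲̲` and an inversion automorphism `ι` (Prop. 1.5 (iii)) with `X̲̲` ι-stable (Def. 2.5 (i)(b)) —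
witness the χ-model. [cite: MochizukiEtTh2009, Def 2.5 (i) p.39] -/
theorem _root_.Literature.AnabelianGeometry.EtaleTheta.ThetaSetting.exists_isEtThOrigin_doubleUnderline_iotaStable
    (l : ℕ+) (hl : Odd (l : ℕ)) :
    ∃ (D : ThetaSetting p) (_ : D.IsEtThOrigin) (E : D.EtaleThetaData) (C : E.DoubleUnderline l)
      (ι : D.PiTemp ≃ₜ* D.PiTemp), E.etaDd ≠ 1 ∧ D.IsInversionAut ι ∧ C.IotaStable ι :=
  ⟨ThetaSetting.modelχ p, ThetaSetting.modelχ_isEtThOrigin p, etaleThetaDataχSec p (etaDdχ p), doubleUnderlineχSec p l hl,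
    twistedInversionTop (chi p) (isInducing_leftRightχ p), etaDdχ_ne_one p, isInversionAut_twistedInversion_modelχ p,
    iotaStable_doubleUnderlineχSec_twistedInversion p l hl⟩

/-! ### Stage 2: the cocycle-corrected inversion of `modelχq` stabilises every `X̲̲ := Huuχq` -/

section Stage2

variable (i j : ℤ) {hj : Even j} (l : ℕ+) (hl : Odd (l : ℕ))

/-- **`IotaStable` HOLDS at the stage-2 constructor sites**: every choice `X̲̲` over `modelχq p i j hj` whose `Π^tp_X̲̲`
is `Huuχq p i j l hl` is stable under the stage-2 inversion (abc-iut-L2-d1's `map_Huuχq_inversionχq`).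
[cite: MochizukiEtTh2009, Def 2.5 (i) p.39] -/
theorem iotaStable_inversionχq_of_Huu_eq {E : (ThetaSetting.modelχq p i j hj).EtaleThetaData}
    (C : E.DoubleUnderline l) (hC : C.Huu = Huuχq p i j l hl) :
    C.IotaStable (inversionχq p i j) :=
  ⟨by rw [hC]; exact map_Huuχq_inversionχq p i j l hl⟩

/-- **`IotaStable` HOLDS for abc-iut-L2-d1's stage-2 constructor `doubleUnderlineχqOfEtaRes`** — for every étale-theta
datum `E` over `modelχq` and every `eta_res` witness. [cite: MochizukiEtTh2009, Def 2.5 (i) p.39] -/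
theorem iotaStable_doubleUnderlineχqOfEtaRes_inversionχq (E : (ThetaSetting.modelχq p i j hj).EtaleThetaData)
    (heta : ∃ (f : ↥((ThetaSetting.modelχq p i j hj).GtpYdd ⊓ Huuχq p i j l hl) →
        (ThetaSetting.modelχq p i j hj).DeltaTheta)
      (hf : f ∈ contCocycles (ThetaSetting.modelχq p i j hj).toTheta (ThetaSetting.modelχq p i j hj).DeltaTheta
        ((ThetaSetting.modelχq p i j hj).GtpYdd ⊓ Huuχq p i j l hl)),
      (∀ g, (f g : (ThetaSetting.modelχq p i j hj).GtpTheta) ∈ (ThetaSetting.modelχq p i j hj).lDeltaTheta l) ∧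
        ContH1.mk f hf = ContH1.res (ThetaSetting.modelχq p i j hj).toTheta (ThetaSetting.modelχq p i j hj).DeltaTheta
          inf_le_left E.etaDd) :
    (ThetaSetting.EtaleThetaData.doubleUnderlineχqOfEtaRes p i j l hl E heta).IotaStable (inversionχq p i j) :=
  iotaStable_inversionχq_of_Huu_eq p i j l hl _ rfl

end Stage2

/-! ### The cusp clause: `CuspAdapted` at the cusped χ-model, vacuous at `modelχ` -/

/-- **`CuspAdapted` HOLDS at the cusped χ-model `modelχ′`** for every choice `X̲̲` with `Π^tp_X̲̲ = Huuχ p l` and every point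
(abc-iut-L2-d1's `map_aug_decomp_inf_Huuχ_modelχ'`: the Galois section `inr` lies in `D_x ∩ Π^tp_X̲̲`).
[cite: MochizukiEtTh2009, Def 2.5 (i) p.39] -/
theorem cuspAdapted_modelχ'_of_Huu_eq {E : (ThetaSetting.modelχ' p).EtaleThetaData} {l : ℕ+}
    (C : E.DoubleUnderline l) (hC : C.Huu = Huuχ p l) (x : (ThetaSetting.modelχ' p).Pt) : C.CuspAdapted x :=
  ⟨by rw [hC]; exact map_aug_decomp_inf_Huuχ_modelχ' p l x⟩

/-- At the cusp-free stage-1 model `modelχ` the cusp clause is VACUOUS: `Pt` is empty, so every `X̲̲` is `CuspAdapted` to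
every (non-existent) point — recorded so that no NV token is read off `modelχ`. [cite: MochizukiEtTh2009, Def 2.5 (i) p.39] -/
theorem cuspAdapted_modelχ_vacuous {E : (ThetaSetting.modelχ p).EtaleThetaData} {l : ℕ} (C : E.DoubleUnderline l)
    (x : (ThetaSetting.modelχ p).Pt) : C.CuspAdapted x :=
  x.elim


/-! ### v2 (append-only): stage 2 — the cocycle-corrected inversion IS an `IsInversionAut`; joint forms -/

section Stage2Joint

variable (i j : ℤ) (hj : Even j) (l : ℕ+) (hl : Odd (l : ℕ))

/-- **`Π^tp_Ÿ̲̲` and `Π^tp_Y̲̲` of every stage-2 `X̲̲ := Huuχq` are ι-stable** for the cocycle-corrected inversion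
(`IotaStable.map_GtpYdd_inf_Huu` / `.map_GtpY_inf_Huu` fed with abc-iut-L2-d1's `isInversionAut_inversionχq`).
[cite: MochizukiEtTh2009, Def 2.7 p.41] -/
theorem map_GtpYdd_inf_Huu_inversionχq_of_Huu_eq {E : (ThetaSetting.modelχq p i j hj).EtaleThetaData}
    (C : E.DoubleUnderline l) (hC : C.Huu = Huuχq p i j l hl) :
    ((ThetaSetting.modelχq p i j hj).GtpYdd ⊓ C.Huu).map (inversionχq p i j).toMulEquiv.toMonoidHom =
      (ThetaSetting.modelχq p i j hj).GtpYdd ⊓ C.Huu ∧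
    ((ThetaSetting.modelχq p i j hj).GtpY ⊓ C.Huu).map (inversionχq p i j).toMulEquiv.toMonoidHom =
      (ThetaSetting.modelχq p i j hj).GtpY ⊓ C.Huu :=
  ⟨(iotaStable_inversionχq_of_Huu_eq p i j l hl C hC).map_GtpYdd_inf_Huu (isInversionAut_inversionχq p i j hj).thm16i,
    (iotaStable_inversionχq_of_Huu_eq p i j l hl C hC).map_GtpY_inf_Huu (isInversionAut_inversionχq p i j hj)⟩

include hl in
/-- **Joint form at stage 2**: over `modelχq p i j hj`, for EVERY étale-theta datum carrying the class of record
`η̈♯ = etaDdχq` over any Kummer datum `K`, there EXIST a choice `X̲̲` and an INVERSION AUTOMORPHISM `ι` (Prop. 1.5 (iii),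
abc-iut-L2-t1's `IsInversionAut`; abc-iut-L2-d1's `isInversionAut_inversionχq`) with `X̲̲` ι-stable — while `Π^tp_X̲̲` is
NOT normal in `Π^tp_X` (`l > 1`, abc-iut-L2-d1's `not_normal_Huuχq`). [cite: MochizukiEtTh2009, Def 2.5 (i) p.39] -/
theorem exists_doubleUnderline_isInversionAut_iotaStable_modelχq (hl1 : 1 < (l : ℕ))
    (K : (ThetaSetting.modelχq p i j hj).KummerData) :
    ∃ (C : (K.etaleThetaDataOfClass (etaDdχq p i j hj)).DoubleUnderline l)
      (ι : (ThetaSetting.modelχq p i j hj).PiTemp ≃ₜ* (ThetaSetting.modelχq p i j hj).PiTemp),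
      (ThetaSetting.modelχq p i j hj).IsInversionAut ι ∧ C.IotaStable ι ∧ C.Huu = Huuχq p i j l hl ∧ ¬ C.Huu.Normal :=
  ⟨(K.etaleThetaDataOfClass (etaDdχq p i j hj)).doubleUnderlineχqOfEtaRes p i j l hl (eta_res_etaDdχq p i j hj l hl),
    inversionχq p i j, isInversionAut_inversionχq p i j hj,
    iotaStable_doubleUnderlineχqOfEtaRes_inversionχq p i j l hl _ _, rfl, not_normal_Huuχq p i j l hl hl1⟩

include hl in
/-- **Setting-free census form, STAGE 2**: some theta setting satisfying the §1 guard `IsEtThOrigin` — the Tate-sheared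
record `modelχq` — carries Kummer data, an étale-theta datum with the class of record, a choice `X̲̲` and an inversion
automorphism `ι` (Prop. 1.5 (iii)) with `X̲̲` ι-stable (Def. 2.5 (i)(b)); Kummer data over `modelχq` exist
(abc-iut-w5-d171's `kummerDataχq`). [cite: MochizukiEtTh2009, Def 2.5 (i) p.39] -/
theorem _root_.Literature.AnabelianGeometry.EtaleTheta.ThetaSetting.exists_isEtThOrigin_doubleUnderline_iotaStable_stageTwo :
    ∃ (D : ThetaSetting p) (_ : D = ThetaSetting.modelχq p i j hj) (_ : D.IsEtThOrigin) (E : D.EtaleThetaData)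
      (C : E.DoubleUnderline l) (ι : D.PiTemp ≃ₜ* D.PiTemp), D.IsInversionAut ι ∧ C.IotaStable ι :=
  ⟨ThetaSetting.modelχq p i j hj, rfl, ThetaSetting.modelχq_isEtThOrigin p i j hj,
    (kummerDataχq p i j hj).etaleThetaDataOfClass (etaDdχq p i j hj),
    ((kummerDataχq p i j hj).etaleThetaDataOfClass (etaDdχq p i j hj)).doubleUnderlineχqOfEtaRes p i j l hl
      (eta_res_etaDdχq p i j hj l hl),
    inversionχq p i j, isInversionAut_inversionχq p i j hj, iotaStable_doubleUnderlineχqOfEtaRes_inversionχq p i j l hl _ _⟩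

end Stage2Joint

end Literature.AnabelianGeometry.EtaleTheta.SettingModel

end
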